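import Summits.Ventures.GridStability.Bench.SMIBDeg2AK13postD10
import Summits.Ventures.GridStability.Lyapunov.CertificateSoundness
import Summits.Ventures.GridStability.Lyapunov.AngleRecovery
import Summits.Ventures.GridStability.Models.SMIB
import Mathlib.Analysis.Calculus.Deriv.Mul
import Mathlib.Analysis.Calculus.Deriv.Pow
import Mathlib.Analysis.Calculus.Deriv.Prod
import Mathlib.Analysis.Normed.Module.FiniteDimension
import Mathlib.Analysis.SpecialFunctions.Trigonometric.Deriv
import HarnessLib

/-!
# G1.SMIB-roa — from the kernel-checked SMIB certificate (deg 2, toolchain A, instance SMIB-K13post-D10)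
# to invariance, no pole slip, and convergence to the synchronous equilibrium FOR THE MODEL M′

Venture GRIDFUSION, `plan/PARTITION.md` A2 (G1-alg / G1-roa), A5 (bridge), A6 (pole-slip rule),
A1′ (instance of record); seat gridfusion-lyap-1 (files the «…Roa» companions, sos-5 19:01:45Z;
director 18:55:42Z (i)). Companion of `Bench/SMIBDeg2AK13postD10{Data,}.lean` (p462357 /
p462567), whose decls it uses VERBATIM (`deg2_A_K13postD10_{f_sigma,f_kappa,f_omega,h,V,Vdot}` and
the four CERTIFIED identities `deg2_A_K13postD10_{V_pos, Vdot_neg, level_in_ball, arc_excl}`);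
the analysis is `Lyapunov/{SublevelTrapping, CertificateSoundness, AngleRecovery}.lean`
(p459619 / p460300 / p460639); the original-coordinate model and the exact embedding are
model-1's `Models/SMIB.lean` (p460909: `SMIB.field`, `SMIB.IsSolutionOn`, `SMIB.embed`,
`SMIB.hasDerivWithinAt_embed`).

THREE COLUMNS. CERTIFIED (kernel, in the Bench file): on `{h = 0}`: `V ≥ (1/100)φ`; on
`{h = 0} ∩ {V ≤ 19/8}`: `V̇ ≤ −(1/2000)φ`, `φ ≤ 1`, `κ ≤ 1`, with `φ = σ² + κ² + ω²/36`.
MODELLED: every theorem of THIS file is about an ODE — the recast polynomial system `ż = F(z)` on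
`{h = 0} ⊂ ℝ³` (`deg2_A_K13postD10_roa`) and model-1's classical SMIB model `M_smib`
(`deg2_A_K13postD10_smib_roa`) for ANY parameter record `p : SMIB` and equilibrium angle `δs`
satisfying the A1′ data relations of the instance (`P_M cos(δs−γ)/M = 532761715096/15538499375`,
`P_M sin(δs−γ)/M = 4303847457/88791425`, `D/M = 10/7`, `P_e(δs) = P_m`) — instance of record
SMIB-K13post-D10 = Kundur 1994 Ex. 13 post-fault plant with `P_m′` (t = 1225/2367) and
`K_D = 10` (MODEL-VALIDITY MV-1); that these rationals ARE that plant's data is model-4's /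
ref-1's exact re-derivation (bench/data/SMIB, PROVENANCE), not a Lean fact here. VALIDATED:
nothing. No sentence of this file says a machine or a grid is stable; «region of attraction»
below means: the stated set of initial conditions OF THE MODEL M′ is carried to the equilibrium.

STATEMENTS. `deg2_A_K13postD10_roa`: for every `0 < γ ≤ 19/8` and every solution `z` of the
recast system on `[0, ∞)` (Mathlib sense: continuous, right derivative `F (z t)`) with
`h(z 0) = 0`, `V(z 0) ≤ γ`: `V(z t) ≤ γ` and `κ(t) ≤ 1` for all `t ≥ 0`, and `z t → 0`.
`deg2_A_K13postD10_smib_roa`: for every solution `(δ, ω)` of `M_smib` on `[0, ∞)` with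
`V(sin u₀, 1 − cos u₀, ω₀) ≤ γ`, `|u₀| < π` (`u = δ − δs`): for all `t ≥ 0`, `V ≤ γ` along the
recast state and `|u t| < π` (no pole slip), and `(δ t, ω t) → (δs, 0)`.
Obligations O1–O10 as in `TOYDeg2handRoa` (template): here the domain is `D = univ` (all four
identities are certified on `{h = 0} ∩ {V ≤ 19/8}` with the `(c − V)` multiplier), `W = (1/2000)φ`
is positive definite (O3/O4 need no second-equilibrium argument), compactness comes from
`level_in_ball` (`‖z‖∞ ≤ 6`), and the arc conjunct `κ ≤ 1` gives `cos u ≥ 0 > −1` for the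
angle recovery. Existence of the global solution: `Literature.Analysis.ODE.exists_global_solution_of_sublevel`
(lit-6, p458002) — not restated.
-/


namespace Summit.Ventures.GridStability.Bench.SMIB

open Set Filter Metric Topology Real
open Summit.Ventures.GridStability.Lyapunov Summit.Ventures.GridStability.Models
open Literature.Computation.Certificates Literature.Computation.Certificates.SOS

noncomputable section

/-! ### Recast phase space `Fin 3 → ℝ`: `z 0 = σ`, `z 1 = κ`, `z 2 = ω` (SOS variable order) -/

/-- The recast SMIB field of the instance on `Fin 3 → ℝ` (components = the Bench decls
`deg2_A_K13postD10_f_sigma/_f_kappa/_f_omega` verbatim = model-1's `SMIB.polyField a b d`, interface I2).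
MODELLED: M′ = SMIB-K13post-D10. [folklore] -/
def deg2_A_K13postD10_F (z : Fin 3 → ℝ) : Fin 3 → ℝ :=
  ![deg2_A_K13postD10_f_sigma (z 0) (z 1) (z 2), deg2_A_K13postD10_f_kappa (z 0) (z 1) (z 2), deg2_A_K13postD10_f_omega (z 0) (z 1) (z 2)]

/-- The certificate's `V` on the phase space. [folklore] -/
def deg2_A_K13postD10_Vz (z : Fin 3 → ℝ) : ℝ := deg2_A_K13postD10_V (z 0) (z 1) (z 2)

/-- Its Lie derivative `∇V·f` (the emitted `deg2_A_K13postD10_Vdot`). [folklore] -/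
def deg2_A_K13postD10_LVz (z : Fin 3 → ℝ) : ℝ := deg2_A_K13postD10_Vdot (z 0) (z 1) (z 2)

/-- The certified dissipation rate `W = ε_dot·φ = (1/2000)(ω²/36 + κ² + σ²)` (right-hand side of
`deg2_A_K13postD10_Vdot_neg` verbatim). [folklore] -/
def deg2_A_K13postD10_Wz (z : Fin 3 → ℝ) : ℝ :=
  (1 / 2000 : ℝ) * (((1 : ℝ) / 36) * z 2 ^ 2 + (1 : ℝ) * z 1 ^ 2 + (1 : ℝ) * z 0 ^ 2)

/-- The recast constraint set `M = {h = 0}`, `h = κ² + σ² − 2κ`. [folklore] -/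
def deg2_A_K13postD10_M : Set (Fin 3 → ℝ) := {z | deg2_A_K13postD10_h (z 0) (z 1) (z 2) = 0}

/-- The certificate's level `c = 19/8` (`lyapunov.level`). [folklore] -/
def deg2_A_K13postD10_level : ℝ := ((19 : ℝ) / 8)

/-- Component `0` (`σ̇`) of the recast field. [folklore] -/
@[simp] theorem deg2_A_K13postD10_F_zero (z : Fin 3 → ℝ) : deg2_A_K13postD10_F z 0 = deg2_A_K13postD10_f_sigma (z 0) (z 1) (z 2) := rfl
/-- Component `1` (`κ̇`) of the recast field. [folklore] -/
@[simp] theorem deg2_A_K13postD10_F_one (z : Fin 3 → ℝ) : deg2_A_K13postD10_F z 1 = deg2_A_K13postD10_f_kappa (z 0) (z 1) (z 2) := rfl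
/-- Component `2` (`ω̇`) of the recast field. [folklore] -/
@[simp] theorem deg2_A_K13postD10_F_two (z : Fin 3 → ℝ) : deg2_A_K13postD10_F z 2 = deg2_A_K13postD10_f_omega (z 0) (z 1) (z 2) := rfl

/-! ### Algebraic consequences of the four certified identities -/

/-- Dissipation inequality in bridge form on `M ∩ {V ≤ c}`: `LV ≤ −W`. CERTIFIED input:
`deg2_A_K13postD10_Vdot_neg`. [folklore] -/
theorem deg2_A_K13postD10_LVz_le {z : Fin 3 → ℝ} (hz : z ∈ deg2_A_K13postD10_M) (hV : deg2_A_K13postD10_Vz z ≤ deg2_A_K13postD10_level) :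
    deg2_A_K13postD10_LVz z ≤ -deg2_A_K13postD10_Wz z := by
  have h := deg2_A_K13postD10_Vdot_neg (z 0) (z 1) (z 2) hV hz
  simp only [deg2_A_K13postD10_LVz, deg2_A_K13postD10_Wz]
  linarith

/-- `W = ε·φ` is positive definite: its only zero is the origin. [folklore] -/
theorem deg2_A_K13postD10_eq_zero_of_Wz {z : Fin 3 → ℝ} (hW : deg2_A_K13postD10_Wz z = 0) : z = 0 := by
  simp only [deg2_A_K13postD10_Wz] at hW
  have h0 : z 0 = 0 := by nlinarith [sq_nonneg (z 0), sq_nonneg (z 1), sq_nonneg (z 2)]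
  have h1 : z 1 = 0 := by nlinarith [sq_nonneg (z 0), sq_nonneg (z 1), sq_nonneg (z 2)]
  have h2 : z 2 = 0 := by nlinarith [sq_nonneg (z 0), sq_nonneg (z 1), sq_nonneg (z 2)]
  funext i
  fin_cases i <;> simp [h0, h1, h2]

/-- Strictness on every level surface `{V = γ}`, `γ > 0`: `W > 0` there (`W = 0` only at `0`,
where `V = 0`). [folklore] -/
theorem deg2_A_K13postD10_Wz_pos {z : Fin 3 → ℝ} {γ : ℝ} (hγ0 : 0 < γ) (hV : deg2_A_K13postD10_Vz z = γ) :
    0 < deg2_A_K13postD10_Wz z := by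
  have hW0 : 0 ≤ deg2_A_K13postD10_Wz z := by simp only [deg2_A_K13postD10_Wz]; positivity
  rcases hW0.lt_or_eq with h | h
  · exact h
  · exfalso
    have hz0 := deg2_A_K13postD10_eq_zero_of_Wz h.symm
    subst hz0
    simp [deg2_A_K13postD10_Vz, deg2_A_K13postD10_V] at hV
    linarith

/-- Arc exclusion (PARTITION A6) on the certified piece: `κ ≤ 1`, i.e. `cos u ≥ 0`.
CERTIFIED input: `deg2_A_K13postD10_arc_excl`. [folklore] -/
theorem deg2_A_K13postD10_kappa_le_one {z : Fin 3 → ℝ} (hz : z ∈ deg2_A_K13postD10_M) (hV : deg2_A_K13postD10_Vz z ≤ deg2_A_K13postD10_level) :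
    z 1 ≤ 1 := by
  have h := deg2_A_K13postD10_arc_excl (z 0) (z 1) (z 2) hV hz
  linarith

/-- Compactness of the certified piece `S = {z ∈ M | V z ≤ c}`: closed, and inside the ball
`σ² + κ² + ω²/36 ≤ 1` (CERTIFIED input `deg2_A_K13postD10_level_in_ball`), hence `‖z‖∞ ≤ (6 : ℝ)`.
[folklore] -/
theorem deg2_A_K13postD10_isCompact_S : IsCompact {z ∈ deg2_A_K13postD10_M | deg2_A_K13postD10_Vz z ≤ deg2_A_K13postD10_level} := by
  have hMc : IsClosed deg2_A_K13postD10_M := by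
    simp only [deg2_A_K13postD10_M, deg2_A_K13postD10_h]
    exact isClosed_eq (by fun_prop) continuous_const
  have hVc : Continuous deg2_A_K13postD10_Vz := by
    unfold deg2_A_K13postD10_Vz deg2_A_K13postD10_V; fun_prop
  have h := isCompact_sublevel_of_norm_le (D := univ) (c := deg2_A_K13postD10_level) (R := (6 : ℝ)) hMc
    isClosed_univ hVc.continuousOn ?_
  · rwa [inter_univ] at h
  rintro z ⟨hz, -⟩ hV
  have hball := deg2_A_K13postD10_level_in_ball (z 0) (z 1) (z 2) hV hz
  have hb0 : |z 0| ≤ (6 : ℝ) :=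
    abs_le.2 (abs_le_of_sq_le_sq' (by nlinarith [sq_nonneg (z 1), sq_nonneg (z 2)]) (by norm_num))
  have hb1 : |z 1| ≤ (6 : ℝ) :=
    abs_le.2 (abs_le_of_sq_le_sq' (by nlinarith [sq_nonneg (z 0), sq_nonneg (z 2)]) (by norm_num))
  have hb2 : |z 2| ≤ (6 : ℝ) :=
    abs_le.2 (abs_le_of_sq_le_sq' (by nlinarith [sq_nonneg (z 0), sq_nonneg (z 1)]) (by norm_num))
  refine (pi_norm_le_iff_of_nonneg (by norm_num)).2 fun i ↦ ?_
  rw [Real.norm_eq_abs]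
  fin_cases i
  · simpa using hb0
  · simpa using hb1
  · simpa using hb2

/-! ### Calculus along a solution of the recast system -/

/-- **Chain rule**: along a curve with right derivative `F (z t)`, `V ∘ z` has derivative
`LV (z t) = Vdot(z t)`. [folklore] -/
theorem deg2_A_K13postD10_hasDerivWithinAt_Vz {z : ℝ → Fin 3 → ℝ} {t : ℝ} {s : Set ℝ}
    (hz : HasDerivWithinAt z (deg2_A_K13postD10_F (z t)) s t) :
    HasDerivWithinAt (deg2_A_K13postD10_Vz ∘ z) (deg2_A_K13postD10_LVz (z t)) s t := by
  have h0 : HasDerivWithinAt (fun τ ↦ z τ 0) (deg2_A_K13postD10_f_sigma (z t 0) (z t 1) (z t 2)) s t := by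
    simpa using (hasDerivWithinAt_pi.1 hz) 0
  have h1 : HasDerivWithinAt (fun τ ↦ z τ 1) (deg2_A_K13postD10_f_kappa (z t 0) (z t 1) (z t 2)) s t := by
    simpa using (hasDerivWithinAt_pi.1 hz) 1
  have h2 : HasDerivWithinAt (fun τ ↦ z τ 2) (deg2_A_K13postD10_f_omega (z t 0) (z t 1) (z t 2)) s t := by
    simpa using (hasDerivWithinAt_pi.1 hz) 2
  have h : HasDerivWithinAt (fun τ ↦
      ((34077 : ℝ) / 10000) * (z τ 0 ^ 0 * (z τ 1 ^ 1 * z τ 2 ^ 0)) +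
      ((37661 : ℝ) / 10000) * (z τ 0 ^ 2 * (z τ 1 ^ 0 * z τ 2 ^ 0)) +
      ((-5057 : ℝ) / 1000) * (z τ 0 ^ 1 * (z τ 1 ^ 1 * z τ 2 ^ 0)) +
      ((3369 : ℝ) / 10000) * (z τ 0 ^ 1 * (z τ 1 ^ 0 * z τ 2 ^ 1)) +
      ((853 : ℝ) / 625) * (z τ 0 ^ 0 * (z τ 1 ^ 2 * z τ 2 ^ 0)) +
      ((1767 : ℝ) / 10000) * (z τ 0 ^ 0 * (z τ 1 ^ 1 * z τ 2 ^ 1)) +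
      ((387 : ℝ) / 2500) * (z τ 0 ^ 0 * (z τ 1 ^ 0 * z τ 2 ^ 2))) _ s t :=
    (((((((((h0.pow 0).mul ((h1.pow 1).mul (h2.pow 0))).const_mul ((34077 : ℝ) / 10000))).add
      (((h0.pow 2).mul ((h1.pow 0).mul (h2.pow 0))).const_mul ((37661 : ℝ) / 10000))).add
      (((h0.pow 1).mul ((h1.pow 1).mul (h2.pow 0))).const_mul ((-5057 : ℝ) / 1000))).add
      (((h0.pow 1).mul ((h1.pow 0).mul (h2.pow 1))).const_mul ((3369 : ℝ) / 10000))).add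
      (((h0.pow 0).mul ((h1.pow 2).mul (h2.pow 0))).const_mul ((853 : ℝ) / 625))).add
      (((h0.pow 0).mul ((h1.pow 1).mul (h2.pow 1))).const_mul ((1767 : ℝ) / 10000))).add
      (((h0.pow 0).mul ((h1.pow 0).mul (h2.pow 2))).const_mul ((387 : ℝ) / 2500))
  have heq : deg2_A_K13postD10_Vz ∘ z = fun τ ↦
      ((34077 : ℝ) / 10000) * (z τ 0 ^ 0 * (z τ 1 ^ 1 * z τ 2 ^ 0)) +
      ((37661 : ℝ) / 10000) * (z τ 0 ^ 2 * (z τ 1 ^ 0 * z τ 2 ^ 0)) +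
      ((-5057 : ℝ) / 1000) * (z τ 0 ^ 1 * (z τ 1 ^ 1 * z τ 2 ^ 0)) +
      ((3369 : ℝ) / 10000) * (z τ 0 ^ 1 * (z τ 1 ^ 0 * z τ 2 ^ 1)) +
      ((853 : ℝ) / 625) * (z τ 0 ^ 0 * (z τ 1 ^ 2 * z τ 2 ^ 0)) +
      ((1767 : ℝ) / 10000) * (z τ 0 ^ 0 * (z τ 1 ^ 1 * z τ 2 ^ 1)) +
      ((387 : ℝ) / 2500) * (z τ 0 ^ 0 * (z τ 1 ^ 0 * z τ 2 ^ 2)) := by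
    funext τ; simp only [Function.comp_apply, deg2_A_K13postD10_Vz, deg2_A_K13postD10_V]; ring
  rw [heq]
  refine h.congr_deriv ?_
  simp only [deg2_A_K13postD10_LVz, deg2_A_K13postD10_Vdot, Pi.pow_apply, Pi.mul_apply]
  push_cast
  ring

/-- **The constraint is a first integral** of the recast field (`ḣ = 2σ·σ̇ + 2κ·κ̇ − 2κ̇ = 0`), so a
solution starting on `M` stays on `M`. [folklore] -/
theorem deg2_A_K13postD10_mem_M {z : ℝ → Fin 3 → ℝ} (hzc : ContinuousOn z (Ici 0))
    (hz : ∀ t, 0 ≤ t → HasDerivWithinAt z (deg2_A_K13postD10_F (z t)) (Ici t) t)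
    (h0 : z 0 ∈ deg2_A_K13postD10_M) : ∀ t, 0 ≤ t → z t ∈ deg2_A_K13postD10_M := by
  intro T hT
  have hderiv : ∀ t ∈ Ico 0 T,
      HasDerivWithinAt (fun τ ↦ deg2_A_K13postD10_h (z τ 0) (z τ 1) (z τ 2)) 0 (Ici t) t := by
    intro t ht
    have hzt := hz t ht.1
    have h0' : HasDerivWithinAt (fun τ ↦ z τ 0) (deg2_A_K13postD10_f_sigma (z t 0) (z t 1) (z t 2)) (Ici t) t := by
      simpa using (hasDerivWithinAt_pi.1 hzt) 0
    have h1' : HasDerivWithinAt (fun τ ↦ z τ 1) (deg2_A_K13postD10_f_kappa (z t 0) (z t 1) (z t 2)) (Ici t) t := by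
      simpa using (hasDerivWithinAt_pi.1 hzt) 1
    have h : HasDerivWithinAt (fun τ ↦ (1 : ℝ) * z τ 1 ^ 2 + (1 : ℝ) * z τ 0 ^ 2 + (-2 : ℝ) * z τ 1)
        _ (Ici t) t :=
      (((h1'.pow 2).const_mul (1 : ℝ)).add ((h0'.pow 2).const_mul (1 : ℝ))).add
        (h1'.const_mul (-2 : ℝ))
    have heq : (fun τ ↦ deg2_A_K13postD10_h (z τ 0) (z τ 1) (z τ 2)) =
        fun τ ↦ (1 : ℝ) * z τ 1 ^ 2 + (1 : ℝ) * z τ 0 ^ 2 + (-2 : ℝ) * z τ 1 := by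
      funext τ; simp only [deg2_A_K13postD10_h]
    rw [heq]
    refine h.congr_deriv ?_
    simp only [deg2_A_K13postD10_f_sigma, deg2_A_K13postD10_f_kappa]
    push_cast
    ring
  have hcont : ContinuousOn (fun τ ↦ deg2_A_K13postD10_h (z τ 0) (z τ 1) (z τ 2)) (Icc 0 T) := by
    have hc : Continuous fun y : Fin 3 → ℝ ↦ deg2_A_K13postD10_h (y 0) (y 1) (y 2) := by
      simp only [deg2_A_K13postD10_h]; fun_prop
    exact hc.comp_continuousOn (hzc.mono fun s hs ↦ hs.1)
  have h := constant_of_has_deriv_right_zero hcont hderiv T ⟨hT, le_rfl⟩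
  have h0' : deg2_A_K13postD10_h (z 0 0) (z 0 1) (z 0 2) = 0 := h0
  show deg2_A_K13postD10_h (z T 0) (z T 1) (z T 2) = 0
  rw [h, h0']

/-! ### G1.SMIB-roa in recast coordinates -/

/-- **G1.SMIB-roa (recast coordinates).** MODELLED: M′ = recast classical SMIB, instance
SMIB-K13post-D10 (model-1's `SMIB.polyField a b d` at model-4's exact data; MV-1), i.e. the
polynomial system `ż = F(z)` on `{h = 0}`. CERTIFIED inputs (kernel-checked in the Bench file):
`deg2_A_K13postD10_{V_pos, Vdot_neg, level_in_ball, arc_excl}`. STATEMENT: for every level `0 < γ ≤ c = 19/8`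
and every solution `z` on `[0, ∞)` (Mathlib sense) with `h(z 0) = 0`, `V(z 0) ≤ γ`:
`V(z t) ≤ γ` and `κ(t) ≤ 1` for all `t ≥ 0` (the piece `{V ≤ γ} ∩ {h = 0}` is positively
invariant and omits the arc `κ > 1`), and `z t → 0` (it lies in the region of attraction of the
equilibrium `z = 0`). Via `Lyapunov.certificate_invariance_tendsto_univ`. No sentence here says a
machine or a grid is stable. [folklore] -/
theorem deg2_A_K13postD10_roa {γ : ℝ} (hγ0 : 0 < γ) (hγ : γ ≤ deg2_A_K13postD10_level) {z : ℝ → Fin 3 → ℝ}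
    (hzc : ContinuousOn z (Ici 0))
    (hz : ∀ t, 0 ≤ t → HasDerivWithinAt z (deg2_A_K13postD10_F (z t)) (Ici t) t)
    (h0M : z 0 ∈ deg2_A_K13postD10_M) (h0V : deg2_A_K13postD10_Vz (z 0) ≤ γ) :
    (∀ t, 0 ≤ t → deg2_A_K13postD10_Vz (z t) ≤ γ ∧ z t 1 ≤ 1) ∧ Tendsto z atTop (𝓝 0) := by
  have hF : Continuous deg2_A_K13postD10_F := by
    refine continuous_pi fun i ↦ ?_
    fin_cases i <;> simp [deg2_A_K13postD10_F, deg2_A_K13postD10_f_sigma, deg2_A_K13postD10_f_kappa, deg2_A_K13postD10_f_omega] <;> fun_prop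
  have hV : Continuous deg2_A_K13postD10_Vz := by unfold deg2_A_K13postD10_Vz deg2_A_K13postD10_V; fun_prop
  have hW : Continuous deg2_A_K13postD10_Wz := by unfold deg2_A_K13postD10_Wz; fun_prop
  have h0 : (0 : Fin 3 → ℝ) ∈ deg2_A_K13postD10_M := by simp [deg2_A_K13postD10_M, deg2_A_K13postD10_h]
  have hMc : IsClosed deg2_A_K13postD10_M := by
    simp only [deg2_A_K13postD10_M, deg2_A_K13postD10_h]
    exact isClosed_eq (by fun_prop) continuous_const
  -- the sub-piece `{V ≤ γ} ∩ M` of the certified piece is compact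
  have hSγ : IsCompact {y ∈ deg2_A_K13postD10_M | deg2_A_K13postD10_Vz y ≤ γ} :=
    deg2_A_K13postD10_isCompact_S.of_isClosed_subset (hMc.inter (isClosed_le hV continuous_const))
      (fun y hy ↦ ⟨hy.1, hy.2.trans hγ⟩)
  have h := certificate_invariance_tendsto_univ (M := deg2_A_K13postD10_M) (LV := deg2_A_K13postD10_LVz) (W := deg2_A_K13postD10_Wz)
    (x₀ := 0) hSγ hF.continuousOn hV.continuousOn hW.continuousOn
    (fun y hy hVy ↦ deg2_A_K13postD10_LVz_le hy (hVy.trans hγ))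
    (fun y _ _ ↦ by simp only [deg2_A_K13postD10_Wz]; positivity)
    (fun y _ hVy ↦ deg2_A_K13postD10_Wz_pos hγ0 hVy)
    h0 (by simp [deg2_A_K13postD10_Vz, deg2_A_K13postD10_V]; exact hγ0.le) (by simp [deg2_A_K13postD10_Wz])
    (fun y _ _ hWy ↦ deg2_A_K13postD10_eq_zero_of_Wz hWy)
    hzc hz (fun t ht ↦ deg2_A_K13postD10_hasDerivWithinAt_Vz (hz t ht)) (deg2_A_K13postD10_mem_M hzc hz h0M) h0V
  have hM := deg2_A_K13postD10_mem_M hzc hz h0M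
  exact ⟨fun t ht ↦ ⟨h.1 t ht, deg2_A_K13postD10_kappa_le_one (hM t ht) ((h.1 t ht).trans hγ)⟩, h.2⟩


/-! ### Back to the machine angle: original coordinates `x = (δ, ω)` via model-1's embedding -/

/-- The image of model-1's embedding `SMIB.embed δs` lies on the recast constraint set. [folklore] -/
theorem deg2_A_K13postD10_embed_mem_M (δs : ℝ) (y : ℝ × ℝ) :
    (fun i : Fin 3 ↦ SMIB.embed δs y i) ∈ deg2_A_K13postD10_M := by
  show deg2_A_K13postD10_h (SMIB.embed δs y ((0 : Fin 3) : ℕ)) (SMIB.embed δs y ((1 : Fin 3) : ℕ))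
    (SMIB.embed δs y ((2 : Fin 3) : ℕ)) = 0
  simp only [Fin.val_zero, Fin.val_one, SMIB.embed_zero, SMIB.embed_one, deg2_A_K13postD10_h]
  nlinarith [sin_sq_add_cos_sq (y.1 - δs)]

/-- **Exact embedding (model-1's chain rule, re-read in the Bench vocabulary).** Along a solution
of the SMIB model `p` whose recast data are the certificate's rationals
(`a = 532761715096/15538499375`, `b = 4303847457/88791425`, `d = 10/7`, PARTITION A1′) and whose equilibrium angle is `δs`,
the recast curve `t ↦ (sin u, 1 − cos u, ω)` solves `ż = F(z)` with the Bench field.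
[folklore] -/
theorem deg2_A_K13postD10_hasDerivWithinAt_embed (p : SMIB) {δs : ℝ} (hM : p.M ≠ 0)
    (ha : ((532761715096/15538499375 : ℚ) : ℝ) = p.PM * cos (δs - p.γ) / p.M)
    (hb : ((4303847457/88791425 : ℚ) : ℝ) = p.PM * sin (δs - p.γ) / p.M)
    (hd : ((10/7 : ℚ) : ℝ) = p.D / p.M) (hP : p.IsEquilibrium δs)
    {x : ℝ → ℝ × ℝ} {s : Set ℝ} (hx : p.IsSolutionOn x s) {t : ℝ} (ht : t ∈ s) :
    HasDerivWithinAt (fun τ ↦ fun i : Fin 3 ↦ SMIB.embed δs (x τ) i)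
      (deg2_A_K13postD10_F (fun i : Fin 3 ↦ SMIB.embed δs (x t) i)) s t := by
  refine hasDerivWithinAt_pi.2 fun i ↦ ?_
  have h := p.hasDerivWithinAt_embed hM ha hb hd hP hx ht i
  refine h.congr_deriv ?_
  fin_cases i <;>
    simp [SMIB.polyField, SMIB.fσ, SMIB.fκ, SMIB.fω, deg2_A_K13postD10_F, deg2_A_K13postD10_f_sigma, deg2_A_K13postD10_f_kappa,
      deg2_A_K13postD10_f_omega, Poly.eval_cons, Poly.eval_nil, Monomial.eval_eq, Monomial.evalFrom_cons,
      Monomial.evalFrom_nil, SMIB.embed, vars_cons_zero, vars_cons_succ] <;> ring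

/-- **G1.SMIB-roa in original coordinates, with angle recovery (A6).** MODELLED: the classical
SMIB model `M_smib` of Anderson–Fouad (2.40)–(2.42) (+ damping, Sauer–Pai (5.157)) as typed by
model-1 (`SMIB.field`, `SMIB.IsSolutionOn`), for ANY parameter record `p` and equilibrium angle
`δs` satisfying the A1′ data relations of the certified instance (`a = P_M c*/M = 532761715096/15538499375`,
`b = P_M s*/M = 4303847457/88791425`, `d = D/M = 10/7`; instance of record SMIB-K13post-D10 = Kundur 1994
Ex. 13 post-fault plant, `P_m′` per A1′, `K_D = 10`, MV-1). CERTIFIED inputs: the four kernel-checked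
identities of the Bench file. STATEMENT: for every `0 < γ ≤ 19/8` and every solution
`x = (δ, ω)` on `[0, ∞)` with `V(sin u₀, 1 − cos u₀, ω₀) ≤ γ` and `|u₀| < π` (`u = δ − δs`): for all
`t ≥ 0`, `V ≤ γ` along the recast state and `|u t| < π` (the relative angle never reaches `±π`:
no pole slip), and `(δ t, ω t) → (δs, 0)`. No sentence here says a machine or a grid is stable.
[folklore] -/
theorem deg2_A_K13postD10_smib_roa (p : SMIB) {δs : ℝ} (hM : p.M ≠ 0)
    (ha : ((532761715096/15538499375 : ℚ) : ℝ) = p.PM * cos (δs - p.γ) / p.M)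
    (hb : ((4303847457/88791425 : ℚ) : ℝ) = p.PM * sin (δs - p.γ) / p.M)
    (hd : ((10/7 : ℚ) : ℝ) = p.D / p.M) (hP : p.IsEquilibrium δs)
    {γ : ℝ} (hγ0 : 0 < γ) (hγ : γ ≤ deg2_A_K13postD10_level) {x : ℝ → ℝ × ℝ} (hx : p.IsSolutionOn x (Ici 0))
    (h0V : deg2_A_K13postD10_V (sin ((x 0).1 - δs)) (1 - cos ((x 0).1 - δs)) (x 0).2 ≤ γ)
    (h0win : |(x 0).1 - δs| < π) :
    (∀ t, 0 ≤ t → deg2_A_K13postD10_V (sin ((x t).1 - δs)) (1 - cos ((x t).1 - δs)) (x t).2 ≤ γ ∧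
      |(x t).1 - δs| < π) ∧ Tendsto x atTop (𝓝 (δs, 0)) := by
  set z : ℝ → Fin 3 → ℝ := fun τ i ↦ SMIB.embed δs (x τ) i with hzdef
  have hxc : ContinuousOn x (Ici 0) := fun t ht ↦ (hx t ht).continuousWithinAt
  have hzc : ContinuousOn z (Ici 0) := by
    have hc : Continuous fun y : ℝ × ℝ ↦ fun i : Fin 3 ↦ SMIB.embed δs y i := by
      refine continuous_pi fun i ↦ ?_
      fin_cases i <;> simp [SMIB.embed] <;> fun_prop
    exact hc.comp_continuousOn hxc
  have hz : ∀ t, 0 ≤ t → HasDerivWithinAt z (deg2_A_K13postD10_F (z t)) (Ici t) t := fun t ht ↦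
    (deg2_A_K13postD10_hasDerivWithinAt_embed p hM ha hb hd hP hx ht).mono (Ici_subset_Ici.2 ht)
  have h0M : z 0 ∈ deg2_A_K13postD10_M := deg2_A_K13postD10_embed_mem_M δs (x 0)
  have h0V' : deg2_A_K13postD10_Vz (z 0) ≤ γ := by simpa [hzdef, deg2_A_K13postD10_Vz] using h0V
  obtain ⟨hinv, hlim⟩ := deg2_A_K13postD10_roa hγ0 hγ hzc hz h0M h0V'
  have hV : ∀ t, 0 ≤ t → deg2_A_K13postD10_V (sin ((x t).1 - δs)) (1 - cos ((x t).1 - δs)) (x t).2 ≤ γ :=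
    fun t ht ↦ by simpa [hzdef, deg2_A_K13postD10_Vz] using (hinv t ht).1
  -- no pole slip: `κ ≤ 1` on the certified piece gives `cos u ≥ 0 > -1`
  have hcos : ∀ t, 0 ≤ t → -1 < cos ((x t).1 - δs) := by
    intro t ht
    have hk := (hinv t ht).2
    simp only [hzdef, Fin.val_one, SMIB.embed_one] at hk
    linarith
  have huc : ContinuousOn (fun t ↦ (x t).1 - δs) (Ici 0) :=
    (continuous_fst.comp_continuousOn hxc).sub continuousOn_const
  have hwin := abs_lt_pi_of_neg_one_lt_cos huc h0win hcos
  have hκ : Tendsto (fun t ↦ 1 - cos ((x t).1 - δs)) atTop (𝓝 0) := by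
    simpa [hzdef] using tendsto_pi_nhds.1 hlim 1
  have hω : Tendsto (fun t ↦ (x t).2) atTop (𝓝 0) := by
    simpa [hzdef] using tendsto_pi_nhds.1 hlim 2
  have hu : Tendsto (fun t ↦ (x t).1 - δs) atTop (𝓝 0) :=
    tendsto_zero_of_one_sub_cos_tendsto hwin hκ
  have hδ : Tendsto (fun t ↦ (x t).1) atTop (𝓝 δs) := by
    have h := hu.add_const δs
    simpa using h
  refine ⟨fun t ht ↦ ⟨hV t ht, hwin t ht⟩, ?_⟩
  have h := hδ.prodMk_nhds hω
  simpa using h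

end

end Summit.Ventures.GridStability.Bench.SMIB
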